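import Literature.Computability.Cryptography.LeftoverHashConditional
import Literature.Computability.Cryptography.EntropyFlatteningConditional
import Literature.Computability.Cryptography.AffineHashStrings
import Literature.Computability.Complexity.InteractiveProofsParallel
import HarnessLib

/-!
# Extracting flattened conditional entropy by universal hashing, in test form (HILL Cor. 4.5.3 / HRV13 §5.3)

> **Håstad–Impagliazzo–Levin–Luby 1999, Corollary 4.5.3** (with Prop. 4.4.1 and Lemma 4.5.1, the Leftover
> Hash Lemma for product distributions): for `k` independent copies of `⟨X, Z⟩` and a universal hash `h_R`
> on the `X`-part to `m = k·H(X | Z) − 2nk^{2/3}` bits, `⟨h_R(X^k), R, Z^k⟩` is statistically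
> indistinguishable from `⟨U_m, R, Z^k⟩`. ("to use Corollary 4.5.3, we need to sacrifice 2nk^{2/3} at each
> stage", §7.)

The tree's rendering with explicit constants: conditional flattening of the `t`-fold product
(`card_condHeavy_tuple_le_exp`, Haitner–Reingold–Vadhan 2013 Lemma 2.1 (2) in counting form: all but an
`e^{−2tη²}` fraction of coin tuples lie in `(x,y)`-fibres of relative size `< 2^{−kmin}` inside their
`y`-fibre, `kmin = t(H(x,y) − H(y)) − tη log₂|Ω|`) combined with the generalized Leftover Hash Lemma in test
form (`LeftoverHash.leftoverHash_cond_test`, Dodis et al. 2008 Lemma 2.4: the fibre bound `M_c = max_a`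
(fibre) satisfies `Σ_c M_c ≤ #heavy + 2^{−kmin}|W|`) for the string-keyed affine family `hashV`
(`isPairwiseIndep_hashV`): for every `[0,1]`-valued test `F` of (side information, key, hash value),
`|E F(y^t, U, h_U(x^t)) − E F(y^t, U, uniform)| ≤ ½ √(2^m (e^{−2tη²} + 2^{−kmin}))` (`extract_cond_test`).
No new named facts.
-/

namespace Literature.Computability.Cryptography

open Finset Real Complexity AffineStr

namespace HILL

namespace Extract

variable {Ω V : Type*} [Fintype Ω] [Nonempty Ω] [DecidableEq Ω] [DecidableEq V] {c t : ℕ}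

/-- The hash input: the `t` strings of the copies as one vector. [folklore] -/
noncomputable def xvec (x : Ω → List.Vector Bool c) (w : Fin t → Ω) : List.Vector Bool (t * c) := tupleVecEquiv t c fun i => x (w i)

/-- The side information: the tuple of the copies' side values. [folklore] -/
def ztup (y : Ω → V) (w : Fin t → Ω) : Fin t → V := fun i => y (w i)

omit [Fintype Ω] [Nonempty Ω] [DecidableEq Ω] [DecidableEq V] in
/-- `xvec` together with `ztup` determines the `(x, y)`-tuple. [folklore] -/
theorem xvec_ztup_inj (x : Ω → List.Vector Bool c) (y : Ω → V) {w w' : Fin t → Ω} (hx : xvec x w = xvec x w') (hz : ztup y w = ztup y w') :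
    (fun i => (x (w i), y (w i))) = fun i => (x (w' i), y (w' i)) := by
  have hx' : (fun i => x (w i)) = fun i => x (w' i) := (tupleVecEquiv t c).injective hx
  funext i
  exact Prod.ext (congrFun hx' i) (congrFun hz i)

/-- **The fibre bound** of the side information: the largest conditional fibre. [folklore] -/
noncomputable def Mfib (x : Ω → List.Vector Bool c) (y : Ω → V) (cv : Fin t → V) : ℕ :=
  Finset.univ.sup fun a : List.Vector Bool (t * c) => (Finset.univ.filter fun w : Fin t → Ω => ztup y w = cv ∧ xvec x w = a).card

omit [Nonempty Ω] [DecidableEq Ω] in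
/-- Every conditional fibre is below the bound. [folklore] -/
theorem card_fibre_le_Mfib (x : Ω → List.Vector Bool c) (y : Ω → V) (cv : Fin t → V) (a : List.Vector Bool (t * c)) :
    (Finset.univ.filter fun w : Fin t → Ω => ztup y w = cv ∧ xvec x w = a).card ≤ Mfib x y cv :=
  Finset.le_sup (f := fun a : List.Vector Bool (t * c) => (Finset.univ.filter fun w : Fin t → Ω => ztup y w = cv ∧ xvec x w = a).card) (Finset.mem_univ a)

omit [Nonempty Ω] [DecidableEq Ω] in
/-- **`Σ_c M_c ≤ #heavy + 2^{−kmin}·|W|`**: on each slice the largest fibre is either heavy (then all of its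
points are heavy) or below `2^{−kmin}` of the slice. [folklore] -/
theorem sum_Mfib_le (x : Ω → List.Vector Bool c) (y : Ω → V) (kmin : ℝ) :
    (∑ cv ∈ (Finset.univ : Finset (Fin t → Ω)).image (ztup y), (Mfib x y cv : ℝ)) ≤
      ((Finset.univ.filter fun w : Fin t → Ω =>
          (2 : ℝ) ^ (-kmin) * ((fiber Finset.univ (fun v : Fin t → Ω => fun i => y (v i)) (fun i => y (w i))).card : ℝ) ≤
            ((fiber Finset.univ (fun v : Fin t → Ω => fun i => (x (v i), y (v i))) (fun i => (x (w i), y (w i)))).card : ℝ)).card : ℝ) +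
        (2 : ℝ) ^ (-kmin) * Fintype.card (Fin t → Ω) := by
  classical
  set heavy : Finset (Fin t → Ω) := Finset.univ.filter fun w : Fin t → Ω =>
      (2 : ℝ) ^ (-kmin) * ((fiber Finset.univ (fun v : Fin t → Ω => fun i => y (v i)) (fun i => y (w i))).card : ℝ) ≤
        ((fiber Finset.univ (fun v : Fin t → Ω => fun i => (x (v i), y (v i))) (fun i => (x (w i), y (w i)))).card : ℝ) with hheavy
  -- per slice
  have hslice : ∀ cv ∈ (Finset.univ : Finset (Fin t → Ω)).image (ztup y),
      (Mfib x y cv : ℝ) ≤ ((heavy.filter fun w => ztup y w = cv).card : ℝ) + (2 : ℝ) ^ (-kmin) * ((Finset.univ.filter fun w : Fin t → Ω => ztup y w = cv).card : ℝ) := by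
    intro cv hcv
    -- a maximising hash value and a point of its fibre
    obtain ⟨a, -, ha⟩ := Finset.exists_max_image (Finset.univ : Finset (List.Vector Bool (t * c)))
      (fun a => (Finset.univ.filter fun w : Fin t → Ω => ztup y w = cv ∧ xvec x w = a).card) Finset.univ_nonempty
    have hM : Mfib x y cv = (Finset.univ.filter fun w : Fin t → Ω => ztup y w = cv ∧ xvec x w = a).card := by
      apply le_antisymm
      · exact Finset.sup_le fun b _ => ha b (Finset.mem_univ b)
      · exact card_fibre_le_Mfib x y cv a
    obtain ⟨w₀, -, hw₀⟩ := Finset.mem_image.1 hcv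
    have hne : (Finset.univ.filter fun w : Fin t → Ω => ztup y w = cv ∧ xvec x w = a).Nonempty := by
      rw [← Finset.card_pos, ← hM]
      refine lt_of_lt_of_le ?_ (card_fibre_le_Mfib x y cv (xvec x w₀))
      exact Finset.card_pos.2 ⟨w₀, Finset.mem_filter.2 ⟨Finset.mem_univ _, hw₀, rfl⟩⟩
    obtain ⟨ws, hws⟩ := hne
    obtain ⟨hzs, hxs⟩ := (Finset.mem_filter.1 hws).2
    -- the two fibres through `ws` are the slice and the maximal fibre
    have hyfib : fiber Finset.univ (fun v : Fin t → Ω => fun i => y (v i)) (fun i => y (ws i)) = Finset.univ.filter fun w : Fin t → Ω => ztup y w = cv := by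
      ext w; simp only [fiber, Finset.mem_filter, Finset.mem_univ, true_and] at hzs ⊢; rw [← hzs]; rfl
    have hxyfib : fiber Finset.univ (fun v : Fin t → Ω => fun i => (x (v i), y (v i))) (fun i => (x (ws i), y (ws i))) =
        Finset.univ.filter fun w : Fin t → Ω => ztup y w = cv ∧ xvec x w = a := by
      ext w
      simp only [fiber, Finset.mem_filter, Finset.mem_univ, true_and]
      constructor
      · intro h
        have hx' : (fun i => x (w i)) = fun i => x (ws i) := funext fun i => congrArg Prod.fst (congrFun h i)
        have hy' : ztup y w = ztup y ws := funext fun i => congrArg Prod.snd (congrFun h i)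
        refine ⟨hy'.trans hzs, ?_⟩
        rw [← hxs, xvec, xvec, hx']
      · rintro ⟨hz, hx⟩
        exact xvec_ztup_inj x y (hx.trans hxs.symm) (hz.trans hzs.symm)
    by_cases hcase : (2 : ℝ) ^ (-kmin) * ((Finset.univ.filter fun w : Fin t → Ω => ztup y w = cv).card : ℝ) ≤
        ((Finset.univ.filter fun w : Fin t → Ω => ztup y w = cv ∧ xvec x w = a).card : ℝ)
    · -- heavy: every point of the maximal fibre is heavy and in the slice
      have hsub : (Finset.univ.filter fun w : Fin t → Ω => ztup y w = cv ∧ xvec x w = a) ⊆ heavy.filter fun w => ztup y w = cv := by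
        intro w hw
        obtain ⟨hzw, hxw⟩ := (Finset.mem_filter.1 hw).2
        refine Finset.mem_filter.2 ⟨Finset.mem_filter.2 ⟨Finset.mem_univ _, ?_⟩, hzw⟩
        have e1 : fiber Finset.univ (fun v : Fin t → Ω => fun i => y (v i)) (fun i => y (w i)) = Finset.univ.filter fun w : Fin t → Ω => ztup y w = cv := by
          ext w'; simp only [fiber, Finset.mem_filter, Finset.mem_univ, true_and] at hzw ⊢; rw [← hzw]; rfl
        have e2 : fiber Finset.univ (fun v : Fin t → Ω => fun i => (x (v i), y (v i))) (fun i => (x (w i), y (w i))) =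
            Finset.univ.filter fun w : Fin t → Ω => ztup y w = cv ∧ xvec x w = a := by
          rw [xvec_ztup_inj x y (hxw.trans hxs.symm) (hzw.trans hzs.symm)]
          exact hxyfib
        rw [e1, e2]; exact hcase
      have := Finset.card_le_card hsub
      have h0 : (0 : ℝ) ≤ (2 : ℝ) ^ (-kmin) * ((Finset.univ.filter fun w : Fin t → Ω => ztup y w = cv).card : ℝ) := by positivity
      rw [hM]
      have : ((Finset.univ.filter fun w : Fin t → Ω => ztup y w = cv ∧ xvec x w = a).card : ℝ) ≤ ((heavy.filter fun w => ztup y w = cv).card : ℝ) := by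
        exact_mod_cast this
      linarith
    · rw [hM]
      have h0 : (0 : ℝ) ≤ ((heavy.filter fun w => ztup y w = cv).card : ℝ) := Nat.cast_nonneg _
      linarith [lt_of_not_ge hcase]
  refine (Finset.sum_le_sum hslice).trans ?_
  rw [Finset.sum_add_distrib, ← Finset.mul_sum]
  refine add_le_add ?_ ?_
  · rw [← Nat.cast_sum, Nat.cast_le]
    rw [← Finset.card_eq_sum_card_fiberwise (f := ztup y) (s := heavy) (t := Finset.univ.image (ztup y)) (fun w _ => Finset.mem_image_of_mem _ (Finset.mem_univ _))]
  · refine mul_le_mul_of_nonneg_left ?_ (by positivity)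
    rw [← Nat.cast_sum, ← Finset.card_eq_sum_card_fiberwise (f := ztup y) (s := Finset.univ) (t := Finset.univ.image (ztup y))
      (fun w _ => Finset.mem_image_of_mem _ (Finset.mem_univ _)), Finset.card_univ]

/-- **Extraction of flattened conditional entropy, in test form** (HILL Cor. 4.5.3 with explicit constants): for
`t ≥ 1` independent copies of the coins, side information the copies' `y`-values, and the affine hash of the
copies' `x`-strings to `m` bits with a uniform key of `≥ m(tc+1)` bits, every `[0,1]`-valued test is fooled up to
`½ √(2^m (e^{−2tη²} + 2^{−(t(H(x,y)−H(y)) − tη log₂|Ω|)}))`.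
[cite: HastadImpagliazzoLevinLuby1999, Cor. 4.5.3 (with Lemma 4.5.1 and Prop. 4.4.1)] -/
theorem extract_cond_test (x : Ω → List.Vector Bool c) (y : Ω → V) (ht : 0 < t) {η : ℝ} (hη : 0 ≤ η) (hΩ : 1 < Fintype.card Ω)
    {m keyLen : ℕ} (hkey : m * (t * c + 1) ≤ keyLen)
    (F : (Fin t → V) → List.Vector Bool keyLen × (Fin m → ZMod 2) → ℝ) (hF0 : ∀ cv p, 0 ≤ F cv p) (hF1 : ∀ cv p, F cv p ≤ 1) :
    |(∑ U : List.Vector Bool keyLen, ∑ w : Fin t → Ω, F (ztup y w) (U, hashV (t * c) m U.toList (xvec x w))) /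
          ((Finset.univ : Finset (List.Vector Bool keyLen)).card * (Finset.univ : Finset (Fin t → Ω)).card) -
        (∑ U : List.Vector Bool keyLen, ∑ w : Fin t → Ω, ∑ u : Fin m → ZMod 2, F (ztup y w) (U, u)) /
          ((Finset.univ : Finset (List.Vector Bool keyLen)).card * (Finset.univ : Finset (Fin t → Ω)).card * Fintype.card (Fin m → ZMod 2))| ≤
      2⁻¹ * Real.sqrt (2 ^ m * (Real.exp (-2 * t * η ^ 2) +
        (2 : ℝ) ^ (-(t * (mapEntropy Finset.univ (fun v => (x v, y v)) - mapEntropy Finset.univ y) - t * η * Real.logb 2 (Fintype.card Ω))))) := by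
  classical
  set kmin : ℝ := t * (mapEntropy Finset.univ (fun v => (x v, y v)) - mapEntropy Finset.univ y) - t * η * Real.logb 2 (Fintype.card Ω) with hkmin
  have hK : LeftoverHash.IsPairwiseIndep (Finset.univ : Finset (List.Vector Bool keyLen)) (fun U a => hashV (t * c) m U.toList a)
      (Finset.univ : Finset (List.Vector Bool (t * c))) := isPairwiseIndep_hashV hkey _
  have h := LeftoverHash.leftoverHash_cond_test Finset.univ_nonempty hK Finset.univ_nonempty (z := ztup y) (x := xvec x)
    (fun w _ => Finset.mem_univ _) (Mfib x y) (fun cv a => card_fibre_le_Mfib x y cv a) F hF0 hF1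
  refine h.trans ?_
  refine mul_le_mul_of_nonneg_left (Real.sqrt_le_sqrt ?_) (by norm_num)
  have hγ : (Fintype.card (Fin m → ZMod 2) : ℝ) = 2 ^ m := by rw [Fintype.card_fun, Fintype.card_fin, ZMod.card]; push_cast; ring
  rw [hγ, mul_div_assoc]
  refine mul_le_mul_of_nonneg_left ?_ (by positivity)
  have hW : ((Finset.univ : Finset (Fin t → Ω)).card : ℝ) = (Fintype.card Ω : ℝ) ^ t := by
    rw [Finset.card_univ, Fintype.card_fun, Fintype.card_fin]; push_cast; ring
  have hWpos : (0 : ℝ) < (Fintype.card Ω : ℝ) ^ t := pow_pos (by exact_mod_cast Fintype.card_pos) t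
  rw [hW, div_le_iff₀ hWpos]
  have hsum := sum_Mfib_le (t := t) x y kmin
  have hheavy := card_condHeavy_tuple_le_exp x y ht hη hΩ
  rw [Fintype.card_fun, Fintype.card_fin] at hsum
  push_cast at hsum
  calc (∑ cv ∈ (Finset.univ : Finset (Fin t → Ω)).image (ztup y), (Mfib x y cv : ℝ))
      ≤ Real.exp (-2 * t * η ^ 2) * (Fintype.card Ω : ℝ) ^ t + (2 : ℝ) ^ (-kmin) * (Fintype.card Ω : ℝ) ^ t := by
        refine hsum.trans (add_le_add hheavy le_rfl)
    _ = (Real.exp (-2 * t * η ^ 2) + (2 : ℝ) ^ (-kmin)) * (Fintype.card Ω : ℝ) ^ t := by ring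

end Extract

end HILL

end Literature.Computability.Cryptography
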